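import Summits.NavierStokesRegularity.FluidComputer.PalasekTowerRegisterAnchored

/-!
# REGISTER v2.3′ = QUIET + GLOBAL ANCHOR (append-only): the items of record `EpisodeBaseG` / `EpisodeInductionG`

Cell `ns-blowup`; bytes by refuter g9 (K49) for planner `ns-blowup-plan` (g16), RULING K49 (STATUS
l.1392), filed by the cell's typist. LABEL: E–C typing (KERNEL vocabulary + glue). WHAT THIS IS NOT: not
Navier–Stokes evidence — one margin clause, two NAMED open `Prop`s at the registered parameters, the
assembly, comparisons and the closer; nothing is inhabited or asserted.

## Why a GLOBAL anchor (refuter K49, planner l.1392), and why a new file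

REGISTER v2.3 (`PalasekTowerRegisterAnchored`) conjoins the level-0 anchor `Schedule.Anchor S u :=
∀ t ∈ [0, τ₀), ∀ x ∈ ball, ‖u t x‖ < c₁ Y₀`, guarded by the registered BALL. The ball radius is not
pinned by `Pins` / `Rigid` / `Quiet` (any re-balling that still confines datum and force is again a
pinned rigid quiet schedule), which leaves two radius corners of the K48 re-reading lever (refuter K49
(B)): (E) a δ-EARLY read in an ENLARGED ball, (L) a LATE read in a SHRUNKEN ball — each evades the
radius premise `hrad` of v2.3's `Stage.τ_zero_le_of_anchor`. ONE-GUARD REPAIR (designer cost nil — every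
design keeps the datum below the level-0 floor everywhere before the push): the GLOBAL anchor

`∀ t ∈ [0, τ₀), ∀ x, ‖u t x‖ < c₁ Y₀`

— `τ₀` is the FIRST time the level-0 floor is met ANYWHERE. Then `Stage.τ_zero_le_of_anchorGlobal` needs
no radius hypothesis (the floor point of the competitor at its own `τ₀` versus the global anchor at the
shared instant), antisymmetry pins `τ₀` (`τ_zero_eq_of_anchorsGlobal`), `Schedule.Rigid` pins every
readout (`τ_eq_of_anchorsGlobal`), and the `∀ S` of the induction ranges over DESIGNS `(u₀, f) ↦ τ`, not
re-readings. The gate's append-only rule forbids mutating the landed `Schedule.Anchor`, so v2.3′ is this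
SEPARATE module: v2.3's names stay byte-identical and are REUSED through the bridge
`Schedule.AnchorGlobal.anchor : S.AnchorGlobal u → S.Anchor u` and `Stage.toRouteA`.

## Contents

* `Schedule.AnchorGlobal S u`, `Schedule.AnchorGlobal.anchor`, `.congr`; `Margins.withAnchorGlobal m`,
  the route margin `Margins.routeG R := withStrain (withAnchorGlobal (register R))`, antitone lemmas;
* `Stage.toRouteA` (a G-stage is an A-stage, same flow), `Stage.addAnchorGlobal`, accessors,
  `Stage.τ_zero_le_of_anchorGlobal` (no `hrad`), `τ_zero_eq_of_anchorsGlobal`, `τ_eq_of_anchorsGlobal`;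
* `@[conjecture] EpisodeBaseG`, `@[conjecture] EpisodeInductionG` (ν = 1, `TowerRates.wide`, `Λ = 8`,
  `θ = 6/5`, `Pins ∧ Rigid ∧ Quiet`, margin `routeG wide`) — THE ITEMS OF RECORD FOR THE BIRTH (v2.3′);
* `nonempty_realisation_of_episodesG`, `palasekStep2_of_episodesG`, closer
  `navierStokesBreakdownR3_of_episodesG : K1G → K2G → W14 → (C)`;
* comparisons: `EpisodeBaseG.episodeBaseA` (hence `…Q`), `EpisodeInductionG.of_episodeInductionA`
  (the global anchor is a `[0, τ₀)` clause inherited along `Stage.Extends`, so K2A ⇒ K2G; hence also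
  K2Q ⇒ K2G and K2R ⇒ K2G), `EpisodeInductionG.of_noRigid`.

References: S. Palasek, arXiv:2605.13827 §3.3, §4 [cite: Palasek2026ElementaryModel, §3–§4];
C. L. Fefferman, Clay problem description, (C) [cite: FeffermanClay2006, (C)]; T. Tao, Anal. PDE 6
(2013), Cor. 11.4 [cite: Tao2011, Cor. 11.4].
-/

noncomputable section

namespace Summit.NavierStokesRegularity.FluidComputer.PalasekTowerClayBridge

open Set MeasureTheory Filter Topology Function
open scoped ENNReal ContDiff NNReal
open Literature.Analysis.FluidPDE

/-! ## §1 The global anchor -/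

/-- **The GLOBAL level-0 ANCHOR** of a velocity history `u` in the schedule `S`: before the first
readout `τ₀` no point of space reaches the level-0 floor speed `c₁ Y₀` — `τ₀` is the FIRST time the
floor is met anywhere (refuter K48 R-anchor, K49 global form; planner RULING K49).
[cite: Palasek2026ElementaryModel, §3.3] -/
def Schedule.AnchorGlobal {R : TowerRates} (S : Schedule R)
    (u : ℝ → EuclideanSpace ℝ (Fin 3) → EuclideanSpace ℝ (Fin 3)) : Prop :=
  ∀ t ∈ Ico 0 (S.τ 0), ∀ x : EuclideanSpace ℝ (Fin 3), ‖u t x‖ < S.c₁ * R.Y 0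

/-- The global anchor implies v2.3's ball-guarded anchor (so every v2.3 lemma is reused). [folklore] -/
theorem Schedule.AnchorGlobal.anchor {R : TowerRates} {S : Schedule R}
    {u : ℝ → EuclideanSpace ℝ (Fin 3) → EuclideanSpace ℝ (Fin 3)} (h : S.AnchorGlobal u) :
    S.Anchor u :=
  fun t ht x _ => h t ht x

/-- The global anchor is inherited by any velocity that agrees with an anchored one on `[0, τ_k]`,
`k ≥ 0` (in particular along `Stage.Extends`). [folklore] -/
theorem Schedule.AnchorGlobal.congr {R : TowerRates} {S : Schedule R} {k : ℕ}
    {u v : ℝ → EuclideanSpace ℝ (Fin 3) → EuclideanSpace ℝ (Fin 3)} (h : S.AnchorGlobal u)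
    (huv : ∀ t ∈ Icc 0 (S.τ k), v t = u t) : S.AnchorGlobal v := by
  intro t ht x
  have ht' : t ∈ Icc 0 (S.τ k) := ⟨ht.1, ht.2.le.trans (S.τ_mono (Nat.zero_le k))⟩
  rw [huv t ht']
  exact h t ht x

/-- **The global anchor added to a margin** (idiom of `Margins.withAnchor`). [folklore] -/
def Margins.withAnchorGlobal {R : TowerRates} (m : Margins R) : Margins R := fun S k u =>
  S.AnchorGlobal u ∧ m S k u

/-- **The route margin of REGISTER v2.3′**: strain floors ∧ (global anchor ∧ (rigidity ∧ core ledger)).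
[folklore] -/
def Margins.routeG (R : TowerRates) : Margins R :=
  Margins.withStrain (Margins.withAnchorGlobal (Margins.register R))

/-- `withAnchorGlobal` keeps a level-antitone margin level-antitone. [folklore] -/
theorem Margins.antitone_withAnchorGlobal {R : TowerRates} {m : Margins R} (hm : m.Antitone) :
    (Margins.withAnchorGlobal m).Antitone :=
  fun S k k' u hk h => ⟨h.1, hm S k k' u hk h.2⟩

/-- The v2.3′ route margin is antitone in the level (so `Stage.restrictOfAntitone` applies). [folklore] -/
theorem Margins.antitone_routeG (R : TowerRates) : (Margins.routeG R).Antitone :=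
  fun _ _ _ _ hk h =>
    ⟨fun j hj => h.1 j (hj.trans hk), h.2.1, Margins.register_mono hk h.2.2⟩

/-! ## §2 Globally anchored stages: accessors, the bridge to v2.3, the dead lever without `hrad` -/

namespace Stage

variable {ν : ℝ} {R : TowerRates} {S S' : Schedule R} {k k' : ℕ}

/-- A globally anchored stage's anchor. [folklore] -/
theorem routeG_anchorGlobal (s : Stage ν R S (Margins.routeG R) k) : S.AnchorGlobal s.u :=
  s.margin.2.1

/-- … its rigidity. [folklore] -/
theorem routeG_rigid (s : Stage ν R S (Margins.routeG R) k) : S.Rigid := s.margin.2.2.1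

/-- … its core ledger. [folklore] -/
theorem routeG_coreLedger (s : Stage ν R S (Margins.routeG R) k) : CoreLedger R S k s.u :=
  s.margin.2.2.2

/-- … its strain floors. [folklore] -/
theorem routeG_strain (s : Stage ν R S (Margins.routeG R) k) :
    ∀ j, j ≤ k → ∃ x, ‖x‖ ≤ S.radius ∧ S.c₁ * R.A j ≤ ‖fderiv ℝ (s.u (S.τ j)) x‖ :=
  s.margin.1

/-- **The bridge to v2.3**: a globally anchored stage is an anchored stage (`Margins.routeA`, same
flow), so every v2.3 construction (`dropAnchor`, the Q/R comparisons, …) applies to it. [folklore] -/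
def toRouteA (s : Stage ν R S (Margins.routeG R) k) : Stage ν R S (Margins.routeA R) k where
  u := s.u
  p := s.p
  classical := s.classical
  initial := s.initial
  energy := s.energy
  floor := s.floor
  ceiling := s.ceiling
  quiet := s.quiet
  margin := ⟨s.margin.1, s.margin.2.1.anchor, s.margin.2.2⟩

/-- The bridged stage has the same velocity. [folklore] -/
theorem toRouteA_u (s : Stage ν R S (Margins.routeG R) k) : s.toRouteA.u = s.u := rfl

/-- The bridged stage has the same pressure. [folklore] -/
theorem toRouteA_p (s : Stage ν R S (Margins.routeG R) k) : s.toRouteA.p = s.p := rfl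

/-- **Adding the global anchor**: an anchored (v2.3) stage whose velocity is globally anchored is a
stage for the v2.3′ margin. [folklore] -/
def addAnchorGlobal (s : Stage ν R S (Margins.routeA R) k) (h : S.AnchorGlobal s.u) :
    Stage ν R S (Margins.routeG R) k where
  u := s.u
  p := s.p
  classical := s.classical
  initial := s.initial
  energy := s.energy
  floor := s.floor
  ceiling := s.ceiling
  quiet := s.quiet
  margin := ⟨s.margin.1, h, s.margin.2.2⟩

/-- **The dead lever, pointwise (no `hU`, no radius premise)**: if a globally anchored stage of `S` and
a stage of `S'` (any margin, ANY ball) share the velocity at `S'`'s first readout and `S'`'s floor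
constant is at least `S`'s, then `S'` does not read level `0` EARLIER than `S`: `S.τ 0 ≤ S'.τ 0` (an
earlier floor point anywhere would contradict the global anchor). This closes the radius corners
(E)/(L) of refuter K49 left by v2.3's `τ_zero_le_of_anchor`. [folklore] -/
theorem τ_zero_le_of_anchorGlobal {m' : Margins R} (s : Stage ν R S (Margins.routeG R) k)
    (s' : Stage ν R S' m' k') (hu : s'.u (S'.τ 0) = s.u (S'.τ 0))
    (hc : S.c₁ ≤ S'.c₁) : S.τ 0 ≤ S'.τ 0 := by
  by_contra hlt
  have hlt' : S'.τ 0 < S.τ 0 := lt_of_not_ge hlt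
  obtain ⟨x, -, hfl⟩ := s'.floor 0 (Nat.zero_le k')
  have hY : 0 < R.Y 0 := Real.rpow_pos_of_pos (R.N_pos 0) _
  have hanch := s.routeG_anchorGlobal (S'.τ 0) ⟨(S'.τ_pos 0).le, hlt'⟩ x
  rw [← hu] at hanch
  have hfl' : S.c₁ * R.Y 0 ≤ ‖s'.u (S'.τ 0) x‖ := le_trans (mul_le_mul_of_nonneg_right hc hY.le) hfl
  exact absurd hanch (not_lt.2 hfl')

/-- **The first readout is a functional of the flow**: two globally anchored stages (of two schedules
with the same floor constant, any balls) sharing their velocity at both first readouts have the same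
`τ₀`. [folklore] -/
theorem τ_zero_eq_of_anchorsGlobal (s : Stage ν R S (Margins.routeG R) k)
    (s' : Stage ν R S' (Margins.routeG R) k') (hu : s'.u (S'.τ 0) = s.u (S'.τ 0))
    (hu' : s.u (S.τ 0) = s'.u (S.τ 0)) (hc : S.c₁ = S'.c₁) : S.τ 0 = S'.τ 0 :=
  le_antisymm (τ_zero_le_of_anchorGlobal s s' hu hc.le) (τ_zero_le_of_anchorGlobal s' s hu' hc.ge)

/-- With rigidity on both sides, equal first readouts give equal readouts at every level. [folklore] -/
theorem τ_eq_of_anchorsGlobal (s : Stage ν R S (Margins.routeG R) k)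
    (s' : Stage ν R S' (Margins.routeG R) k') (hu : s'.u (S'.τ 0) = s.u (S'.τ 0))
    (hu' : s.u (S.τ 0) = s'.u (S.τ 0)) (hc : S.c₁ = S'.c₁) : S.τ = S'.τ :=
  s.routeG_rigid.τ_eq_of_τ_zero_eq s'.routeG_rigid (τ_zero_eq_of_anchorsGlobal s s' hu hu' hc)

end Stage

/-! ## §3 The v2.3′ items of record (never asserted here) -/

/-- **K1G — the globally anchored quiet episode base** (open; never asserted): a pinned (`Λ = 8`,
`θ = 6/5`), rigid, quiet schedule on the wide-base rates carries a GLOBALLY ANCHORED, strained, cored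
stage at level `1` at unit viscosity. [cite: Palasek2026ElementaryModel, §4] -/
@[conjecture] def EpisodeBaseG : Prop :=
  ∃ S : Schedule TowerRates.wide, S.Pins 8 (6 / 5) ∧ S.Rigid ∧ S.Quiet ∧
    Nonempty (Stage 1 TowerRates.wide S (Margins.routeG TowerRates.wide) 1)

/-- **K2G — the globally anchored quiet episode induction** (open; the hard piece; never asserted):
over pinned, rigid, quiet schedules on the wide-base rates, every globally anchored strained cored
stage at level `k ≥ 1` extends to level `k+1` — autonomous heredity of DESIGNS (the global anchor
removes every re-reading, radius corners included). [cite: Palasek2026ElementaryModel, §4] -/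
@[conjecture] def EpisodeInductionG : Prop :=
  ∀ S : Schedule TowerRates.wide, S.Pins 8 (6 / 5) → S.Rigid → S.Quiet → ∀ k : ℕ, 1 ≤ k →
    ∀ s : Stage 1 TowerRates.wide S (Margins.routeG TowerRates.wide) k,
      ∃ s' : Stage 1 TowerRates.wide S (Margins.routeG TowerRates.wide) (k + 1), s.Extends s'

/-! ## §4 Assembly, comparisons, closer -/

/-- **K1G ∧ K2G ⇒ the interface is inhabited at unit viscosity** (verbatim the Q/R/A assembly).
[cite: Palasek2026ElementaryModel, §4] -/
theorem nonempty_realisation_of_episodesG (h₁ : EpisodeBaseG) (h₂ : EpisodeInductionG) :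
    Nonempty (Realisation 1 TowerRates.wide) := by
  obtain ⟨S, hP, hR, hQ, ⟨s₁⟩⟩ := h₁
  exact ⟨Realisation.ofEpisodes S s₁ (fun n s => h₂ S hP hR hQ (n + 1) (by omega) s)⟩

/-- The globally anchored base implies the anchored (v2.3) base (bridge). [folklore] -/
theorem EpisodeBaseG.episodeBaseA (h : EpisodeBaseG) : EpisodeBaseA := by
  obtain ⟨S, hP, hR, hQ, ⟨s⟩⟩ := h
  exact ⟨S, hP, hR, hQ, ⟨s.toRouteA⟩⟩

/-- … hence also the quiet (v2.2) base. [folklore] -/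
theorem EpisodeBaseG.episodeBaseQ (h : EpisodeBaseG) : EpisodeBaseQ :=
  h.episodeBaseA.episodeBaseQ

/-- **The anchored (v2.3) induction implies the globally anchored one**: bridge to `routeA`, extend by
K2A, and inherit the global anchor along `Extends` (it is a `[0, τ₀)` clause). So v2.3 is superseded by
v2.3′, not refuted by it. [folklore] -/
theorem EpisodeInductionG.of_episodeInductionA (h : EpisodeInductionA) : EpisodeInductionG := by
  intro S hP hR hQ k hk s
  obtain ⟨s', hs'⟩ := h S hP hR hQ k hk s.toRouteA
  have hanch : S.AnchorGlobal s'.u :=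
    (s.routeG_anchorGlobal).congr (k := k) (fun t ht => (hs' t ht).1)
  refine ⟨s'.addAnchorGlobal hanch, fun t ht => ?_⟩
  exact hs' t ht

/-- … hence the quiet (v2.2) induction implies the globally anchored one. [folklore] -/
theorem EpisodeInductionG.of_episodeInductionQ (h : EpisodeInductionQ) : EpisodeInductionG :=
  EpisodeInductionG.of_episodeInductionA (EpisodeInductionA.of_episodeInductionQ h)

/-- … and the v2.1 ∀-robust induction implies the globally anchored one. [folklore] -/
theorem EpisodeInductionG.of_episodeInductionR (h : EpisodeInductionR) : EpisodeInductionG :=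
  EpisodeInductionG.of_episodeInductionA (EpisodeInductionA.of_episodeInductionR h)

/-- The rigidity hypothesis of K2G is redundant given the stage (the margin carries it). [folklore] -/
theorem EpisodeInductionG.of_noRigid
    (h : ∀ S : Schedule TowerRates.wide, S.Pins 8 (6 / 5) → S.Quiet → ∀ k : ℕ, 1 ≤ k →
      ∀ s : Stage 1 TowerRates.wide S (Margins.routeG TowerRates.wide) k,
        ∃ s' : Stage 1 TowerRates.wide S (Margins.routeG TowerRates.wide) (k + 1), s.Extends s') :
    EpisodeInductionG :=
  fun S hP _ hQ k hk s => h S hP hQ k hk s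

/-- K1G ∧ K2G ⇒ Palasek's Step 2 for the wide-base rates (all viscosities).
[cite: Palasek2026ElementaryModel, §4] -/
theorem palasekStep2_of_episodesG (h₁ : EpisodeBaseG) (h₂ : EpisodeInductionG) :
    PalasekStep2 TowerRates.wide := by
  obtain ⟨W⟩ := nonempty_realisation_of_episodesG h₁ h₂
  exact palasekStep2_of_realisation one_pos W

/-- **CLOSER (v2.3′ items of record).** K1G → K2G → W14 → Fefferman's (C); W14 = the Literature named
fact `tao2011_forced_unconditionalUniqueness_velocity` (UNPROVED; hypothesis) fed through
`.schwartzForce` to the landed bridge. Conditional on all three; none is asserted.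
[cite: FeffermanClay2006, (C)] [cite: Tao2011, Cor. 11.4] -/
theorem navierStokesBreakdownR3_of_episodesG (h₁ : EpisodeBaseG) (h₂ : EpisodeInductionG)
    (hU : tao2011_forced_unconditionalUniqueness_velocity) :
    Summit.NavierStokesRegularity.NavierStokesRegularity.NavierStokesBreakdownR3 :=
  navierStokesBreakdownR3_of_step2 TowerRates.wide
    (tao2011_forced_unconditionalUniqueness_velocity.schwartzForce hU)
    (palasekStep2_of_episodesG h₁ h₂)

end Summit.NavierStokesRegularity.FluidComputer.PalasekTowerClayBridge

end
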